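import Summits.CriticalPhenomena.PercolationContinuityZ3.Theorems.FK.InfiniteVolumeGibbs
import Summits.CriticalPhenomena.PercolationContinuityZ3.Theorems.FK.InfiniteVolumeDLRFinite
import Literature.Probability.Percolation.RSWProofs
import HarnessLib

/-!
# FK-continuity transplant, FO-06 (interface half): the box limits `φ⁰_{p,q}`, `φ¹_{p,q}` satisfy the sandwich
# form of the DLR property — `IsBoxLimit d b p q P → FKGibbs d p q P`

Cell `fk-continuity` (bschramm), row FO-06a-2; support file for the FK-continuity transplant
(`--supports stmt-CriticalPhenomena-4575`); builds on p205010 (kernel theorem, internal audit signed; external expert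
review pending).  Pure proofs; no definitions, no named facts, no sorries.

* `regionFreeReal_mul_rcBoxMeasure_le`, `rcBoxMeasure_le_regionWiredReal_mul` — the sandwich IN THE BOX `Λ_n` for a
  region `Λ ⊆ Λ_n` (Grimmett 2006, Lemma (4.13) with Lemma (4.14)(b)), read on `ℤ^d`:
  `φ⁰_{Λ,p,q}(A) · φ^b_{Λ_n,p,q}(H) ≤ φ^b_{Λ_n,p,q}(A ∩ H) ≤ φ¹_{Λ,p,q}(A) · φ^b_{Λ_n,p,q}(H)` for `A` increasing
  determined by `E_Λ` and `H` determined by finitely many pairs off `E_Λ` — from the finite-volume sandwich and the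
  two transports of `InfiniteVolumeDLRFinite.lean`, with the comparison of wired sets
  `rcMeasure_real_mono_wired_of_isUpperSet` (free region ≤ region wired like the ambient box).
* `IsBoxLimit.regionFreeReal_mul_le`, `IsBoxLimit.le_regionWiredReal_mul` — the same for the LIMIT `P = φ^b_{p,q}`
  (both sides are limits of box probabilities of local events, Grimmett 2006 (4.20)).
* `IsBoxLimit.fkGibbs` — **every box limit satisfies the cell's interface `FKGibbs`** (`p ∈ [0,1]`, `q ≥ 1`, both
  boundary conditions); `fkGibbs_rcLimit_of_exists` for the cell's `rcLimit`.

## References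

* G. Grimmett, *The Random-Cluster Model*, Springer 2006: §4.2 Lemma (4.13), Lemma (4.14)(b); §4.3 Thm. (4.19)(a),
  (4.20), (4.21). [Grimmett2006]
* G. Grimmett, *Percolation*, 2nd ed., Springer 1999, §2.2 (local events). [GrimmettPercolation1999]
-/

noncomputable section

open MeasureTheory Set Filter
open scoped Topology ENNReal

namespace Summit.CriticalPhenomena.PercolationContinuityZ3.Theorems.FK

open Literature.Probability.Percolation Literature.Probability.LatticeModels

/-! ## The box laws: sandwich in `Λ_n` for a region `Λ ⊆ Λ_n`, read on `ℤ^d` -/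

section BoxLaw

open Finset SimpleGraph

variable {d : ℕ}

/-- `liftEdges` is monotone (also in the cell's `InfiniteVolumeBoxLaws.lean`; private copy to keep the import list
minimal). [cite: Grimmett2006, §4.2] -/
private theorem liftEdges_mono' (Δ : Finset (Site d)) : Monotone (liftEdges Δ) := fun _ _ h => Set.image_mono h

/-- A finite region lies in the boxes `Λ_n` from `n ≥ max siteRad` on. [cite: Grimmett2006, §4.2 (boxes Λ_n ↑ ℤ^d)] -/
theorem subset_box_of_sup_siteRad_le {Λ : Finset (Site d)} {n : ℕ} (hn : Λ.sup siteRad ≤ n) : Λ ⊆ box d n :=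
  fun _ hx => mem_box_iff_siteRad_le.2 ((Finset.le_sup hx).trans hn)

/-- **Lower sandwich for the box laws**: for `Λ ⊆ Λ_n`, an increasing event `A` determined by `E_Λ` and an event
`H` determined by a finite pair set disjoint from `E_Λ`,
`φ⁰_{Λ,p,q}(A) · φ^b_{Λ_n,p,q}(H) ≤ φ^b_{Λ_n,p,q}(A ∩ H)` (events read on `ℤ^d`).
[cite: Grimmett2006, Lemma (4.13) and Lemma (4.14)(b)] -/
theorem regionFreeReal_mul_rcBoxMeasure_le {p q : ℝ} (hp : p ∈ Set.Icc (0 : ℝ) 1) (hq : 1 ≤ q) (b : Bool)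
    {n : ℕ} {Λ : Finset (Site d)} (hΛ : Λ ⊆ box d n) {A H : Set (BondConfig (Site d))}
    (T : Finset (Sym2 (Site d))) (hA : IsUpperSet A) (hAΛ : DeterminedBy A ↑(edgesIn (zdGraph d) Λ))
    (hT : Disjoint (↑T : Set (Sym2 (Site d))) ↑(edgesIn (zdGraph d) Λ)) (hH : DeterminedBy H ↑T) :
    regionFreeReal d p q Λ A * (rcBoxMeasure d b p q n).real (liftEdges (box d n) ⁻¹' H) ≤
      (rcBoxMeasure d b p q n).real (liftEdges (box d n) ⁻¹' (A ∩ H)) := by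
  have hq0 : 0 < q := one_pos.trans_le hq
  set U := insideEdges (zdGraph d) hΛ with hU
  have hAU : ∀ ω, ω ∈ liftEdges (box d n) ⁻¹' A ↔ ω ∩ ↑U ∈ liftEdges (box d n) ⁻¹' A :=
    mem_preimage_liftEdges_iff_inter (fun e he =>
      Finset.mem_coe.2 ((mem_insideEdges_iff_map_val_mem_edgesIn hΛ e).2 he)) hAΛ
  have hS : ∀ ω, ω ∈ liftEdges (box d n) ⁻¹' H ↔ ω ∩ (↑U : Set (Sym2 ↥(box d n)))ᶜ ∈ liftEdges (box d n) ⁻¹' H :=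
    mem_preimage_liftEdges_iff_inter (fun e he heU =>
      Set.disjoint_left.1 hT he ((mem_insideEdges_iff_map_val_mem_edgesIn hΛ e).1 heU)) hH
  have hAup : IsUpperSet (liftEdges (box d n) ⁻¹' A) := hA.preimage (liftEdges_mono' _)
  have key := rcMeasure_fromEdgeSet_real_mul_le_real_inter (finsetGraph (zdGraph d) (box d n)) hp hq
    (boxBC d b n) U (insideEdges_subset_edgeFinset hΛ) hAup hAU hS
  have hfree : regionFreeReal d p q Λ A ≤
      (rcMeasure (fromEdgeSet (↑U : Set (Sym2 ↥(box d n)))) p q (boxBC d b n)).real (liftEdges (box d n) ⁻¹' A) := by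
    rw [regionFreeReal, ← rcMeasure_fromEdgeSet_insideEdges_empty_real hp hq0 hΛ A]
    exact rcMeasure_real_mono_wired_of_isUpperSet _ hp hq (Set.empty_subset _) hAup
  rw [Set.preimage_inter]
  exact (mul_le_mul_of_nonneg_right hfree measureReal_nonneg).trans key

/-- **Upper sandwich for the box laws**: with `Λ`, `A`, `H` as above,
`φ^b_{Λ_n,p,q}(A ∩ H) ≤ φ¹_{Λ,p,q}(A) · φ^b_{Λ_n,p,q}(H)`. [cite: Grimmett2006, Lemma (4.13) and Lemma (4.14)(b)] -/
theorem rcBoxMeasure_le_regionWiredReal_mul {p q : ℝ} (hp : p ∈ Set.Icc (0 : ℝ) 1) (hq : 1 ≤ q) (b : Bool)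
    {n : ℕ} {Λ : Finset (Site d)} (hΛ : Λ ⊆ box d n) {A H : Set (BondConfig (Site d))}
    (T : Finset (Sym2 (Site d))) (hA : IsUpperSet A) (hAΛ : DeterminedBy A ↑(edgesIn (zdGraph d) Λ))
    (hT : Disjoint (↑T : Set (Sym2 (Site d))) ↑(edgesIn (zdGraph d) Λ)) (hH : DeterminedBy H ↑T) :
    (rcBoxMeasure d b p q n).real (liftEdges (box d n) ⁻¹' (A ∩ H)) ≤
      regionWiredReal d p q Λ A * (rcBoxMeasure d b p q n).real (liftEdges (box d n) ⁻¹' H) := by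
  have hq0 : 0 < q := one_pos.trans_le hq
  haveI : IsProbabilityMeasure (rcBoxMeasure d b p q n) := isProbabilityMeasure_rcMeasure _ hp hq0 _
  -- degenerate case: `E_Λ = ∅`, then `A` is trivial
  by_cases hE : (edgesIn (zdGraph d) Λ).Nonempty
  swap
  · rw [Finset.not_nonempty_iff_eq_empty] at hE
    rw [hE, Finset.coe_empty] at hAΛ
    have htriv : ∀ ω ω' : BondConfig (Site d), (ω ∈ A ↔ ω' ∈ A) := fun ω ω' =>
      (determinedBy_iff _ _).1 hAΛ ω ω' (by simp)
    by_cases h0 : (∅ : BondConfig (Site d)) ∈ A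
    · have hAu : A = Set.univ := Set.eq_univ_of_forall fun ω => (htriv ω ∅).2 h0
      subst hAu
      have h1 : regionWiredReal d p q Λ Set.univ = 1 := by
        haveI := isProbabilityMeasure_rcMeasure (finsetGraph (zdGraph d) Λ) hp hq0 (wiredBoundary (zdGraph d) Λ)
        rw [regionWiredReal, Set.preimage_univ, probReal_univ]
      rw [h1, one_mul, Set.univ_inter]
    · have hAe : A = ∅ := Set.eq_empty_of_forall_notMem fun ω hω => h0 ((htriv ω ∅).1 hω)
      subst hAe
      rw [Set.empty_inter, Set.preimage_empty, measureReal_empty]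
      exact mul_nonneg measureReal_nonneg measureReal_nonneg
  set U := insideEdges (zdGraph d) hΛ with hU
  have hAU : ∀ ω, ω ∈ liftEdges (box d n) ⁻¹' A ↔ ω ∩ ↑U ∈ liftEdges (box d n) ⁻¹' A :=
    mem_preimage_liftEdges_iff_inter (fun e he =>
      Finset.mem_coe.2 ((mem_insideEdges_iff_map_val_mem_edgesIn hΛ e).2 he)) hAΛ
  have hS : ∀ ω, ω ∈ liftEdges (box d n) ⁻¹' H ↔ ω ∩ (↑U : Set (Sym2 ↥(box d n)))ᶜ ∈ liftEdges (box d n) ⁻¹' H :=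
    mem_preimage_liftEdges_iff_inter (fun e he heU =>
      Set.disjoint_left.1 hT he ((mem_insideEdges_iff_map_val_mem_edgesIn hΛ e).1 heU)) hH
  have hAup : IsUpperSet (liftEdges (box d n) ⁻¹' A) := hA.preimage (liftEdges_mono' _)
  have hBW : boxBC d b n ⊆ envSet (zdGraph d) Λ (box d n) := by
    cases b
    · simp [boxBC]
    · simpa [boxBC] using wiredBoundary_subset_envSet hΛ
  have key := rcMeasure_real_inter_le_fromEdgeSet_real_mul (finsetGraph (zdGraph d) (box d n)) hp hq
    (boxBC d b n) U (insideEdges_subset_edgeFinset hΛ) hBW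
    (fun e he heU => mem_envSet_of_mem_edgeSet_of_notMem_insideEdges hΛ he heU) hAup hAU hS
  rw [rcMeasure_fromEdgeSet_insideEdges_envSet_real hp hq0 hΛ (wiredBoundary_nonempty_of_edgesIn_nonempty hE) A]
    at key
  rw [Set.preimage_inter, regionWiredReal]
  exact key

end BoxLaw

/-! ## The limit measures satisfy the sandwich: `IsBoxLimit → FKGibbs` -/

section Limit

open Finset

variable {d : ℕ} {b : Bool} {p q : ℝ} {P : Measure (BondConfig (Site d))}

/-- Real-valued convergence of the box laws on a local event, written on the box:
`φ^b_{Λ_n,p,q}(liftEdges⁻¹ X) → P(X)`. [cite: Grimmett2006, Thm. (4.19)(a)] -/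
theorem IsBoxLimit.tendsto_rcBoxMeasure_real_preimage (hP : IsBoxLimit d b p q P)
    {X : Set (BondConfig (Site d))} (hX : IsLocalEvent X) :
    Tendsto (fun n => (rcBoxMeasure d b p q n).real (liftEdges (box d n) ⁻¹' X)) atTop (𝓝 (P.real X)) := by
  haveI := hP.isProbabilityMeasure
  have h := (ENNReal.tendsto_toReal (measure_ne_top P X)).comp (hP.tendsto_of_isLocalEvent X hX)
  refine h.congr fun n => ?_
  simp only [Function.comp_apply, rcBoxLaw, ← measureReal_def]
  exact map_measureReal_apply (measurable_of_finite _) (measurableSet_of_isLocalEvent_holds hX)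

/-- A non-lattice pair is almost surely closed under every box law. [cite: Grimmett2006, §4.2 (Ω = {0,1}^{𝔼^d})] -/
private theorem rcBoxLaw_setOf_mem_eq_zero' (b : Bool) {p q : ℝ} (hp : p ∈ Set.Icc (0 : ℝ) 1) (hq : 0 < q)
    (n : ℕ) {e : Sym2 (Site d)} (he : e ∉ (zdGraph d).edgeSet) : rcBoxLaw d b p q n {ω | e ∈ ω} = 0 := by
  rw [rcBoxLaw, Measure.map_apply (measurable_of_finite _)
    (measurableSet_of_isLocalEvent_holds (isLocalEvent_setOf_mem e))]
  set G := finsetGraph (zdGraph d) (box d n)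
  haveI : IsProbabilityMeasure (rcBoxMeasure d b p q n) := isProbabilityMeasure_rcMeasure G hp hq _
  have hsub : liftEdges (box d n) ⁻¹' {ω : BondConfig (Site d) | e ∈ ω} ⊆
      {ω : BondConfig ↥(box d n) | ¬ ω ⊆ G.edgeSet} := by
    intro ω hω hωE
    obtain ⟨e', he', rfl⟩ := mem_liftEdges_iff.1 hω
    apply he
    have h1 := hωE he'
    induction e' using Sym2.ind with
    | h a c => exact (SimpleGraph.mem_edgeSet _).2 ((SimpleGraph.mem_edgeSet _).1 h1)
  have h := rcMeasure_real_mono_on_edgeSets G hp hq (boxBC d b n)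
    (A := {ω : BondConfig ↥(box d n) | ¬ ω ⊆ G.edgeSet}) (A' := ∅) (fun ω hωE hω => (hω hωE).elim)
  rw [measureReal_empty] at h
  exact measure_mono_null hsub ((measureReal_eq_zero_iff (measure_ne_top _ _)).1 (le_antisymm h measureReal_nonneg))

/-- A box limit is carried by lattice configurations (also in the cell's `InfiniteVolumeMeasures.lean`; private copy
to keep this file independent of it). [cite: Grimmett2006, §4.2 (Ω = {0,1}^{𝔼^d})] -/
private theorem ae_subset_edgeSet' (hP : IsBoxLimit d b p q P) (hp : p ∈ Set.Icc (0 : ℝ) 1) (hq : 0 < q) :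
    ∀ᵐ ω ∂P, ω ⊆ (zdGraph d).edgeSet :=
  ae_subset_of_measure_setOf_mem_eq_zero P _ fun _ he =>
    measure_setOf_mem_eq_zero_of_tendsto hP.tendsto_of_isLocalEvent fun n => rcBoxLaw_setOf_mem_eq_zero' b hp hq n he

/-- **Lower sandwich for `φ^b_{p,q}`** (Grimmett 2006, Lemma (4.13) + (4.14)(b) in the limit (4.20)): if `P` is the
box limit with boundary condition `b` (`p ∈ [0,1]`, `q ≥ 1`), then for every finite region `Λ`, increasing `A`
determined by `E_Λ` and `H` determined by a finite pair set disjoint from `E_Λ`,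
`φ⁰_{Λ,p,q}(A) · P(H) ≤ P(A ∩ H)`. [cite: Grimmett2006, Lemma (4.13), Lemma (4.14)(b), Thm. (4.19)(a)] -/
theorem IsBoxLimit.regionFreeReal_mul_le (hP : IsBoxLimit d b p q P) (hp : p ∈ Set.Icc (0 : ℝ) 1) (hq : 1 ≤ q)
    (Λ : Finset (Site d)) {A H : Set (BondConfig (Site d))} (T : Finset (Sym2 (Site d))) (hA : IsUpperSet A)
    (hAΛ : DeterminedBy A ↑(edgesIn (zdGraph d) Λ)) (hT : Disjoint (↑T : Set (Sym2 (Site d))) ↑(edgesIn (zdGraph d) Λ))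
    (hH : DeterminedBy H ↑T) : regionFreeReal d p q Λ A * P.real H ≤ P.real (A ∩ H) := by
  classical
  have hHl : IsLocalEvent H := ⟨T, hH⟩
  have hAl : IsLocalEvent A := ⟨_, hAΛ⟩
  refine le_of_tendsto_of_tendsto ((hP.tendsto_rcBoxMeasure_real_preimage hHl).const_mul _)
    (hP.tendsto_rcBoxMeasure_real_preimage (hAl.inter hHl)) ?_
  rw [Filter.EventuallyLE, Filter.eventually_atTop]
  exact ⟨Λ.sup siteRad, fun n hn =>
    regionFreeReal_mul_rcBoxMeasure_le hp hq b (subset_box_of_sup_siteRad_le hn) T hA hAΛ hT hH⟩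

/-- **Upper sandwich for `φ^b_{p,q}`**: with `Λ`, `A`, `H` as above, `P(A ∩ H) ≤ φ¹_{Λ,p,q}(A) · P(H)`.
[cite: Grimmett2006, Lemma (4.13), Lemma (4.14)(b), Thm. (4.19)(a)] -/
theorem IsBoxLimit.le_regionWiredReal_mul (hP : IsBoxLimit d b p q P) (hp : p ∈ Set.Icc (0 : ℝ) 1) (hq : 1 ≤ q)
    (Λ : Finset (Site d)) {A H : Set (BondConfig (Site d))} (T : Finset (Sym2 (Site d))) (hA : IsUpperSet A)
    (hAΛ : DeterminedBy A ↑(edgesIn (zdGraph d) Λ)) (hT : Disjoint (↑T : Set (Sym2 (Site d))) ↑(edgesIn (zdGraph d) Λ))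
    (hH : DeterminedBy H ↑T) : P.real (A ∩ H) ≤ regionWiredReal d p q Λ A * P.real H := by
  classical
  have hHl : IsLocalEvent H := ⟨T, hH⟩
  have hAl : IsLocalEvent A := ⟨_, hAΛ⟩
  refine le_of_tendsto_of_tendsto (hP.tendsto_rcBoxMeasure_real_preimage (hAl.inter hHl))
    ((hP.tendsto_rcBoxMeasure_real_preimage hHl).const_mul _) ?_
  rw [Filter.EventuallyLE, Filter.eventually_atTop]
  exact ⟨Λ.sup siteRad, fun n hn =>
    rcBoxMeasure_le_regionWiredReal_mul hp hq b (subset_box_of_sup_siteRad_le hn) T hA hAΛ hT hH⟩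

/-- **`φ^b_{p,q}` is an infinite-volume random-cluster measure in the sandwich sense**: every box limit `P`
(`IsBoxLimit d b p q P`, `p ∈ [0,1]`, `q ≥ 1`, `b ∈ {free, wired}`) satisfies the interface `FKGibbs d p q P`.
[cite: Grimmett2006, Lemma (4.13), Lemma (4.14)(b), Thm. (4.19)(a)] -/
theorem IsBoxLimit.fkGibbs (hP : IsBoxLimit d b p q P) (hp : p ∈ Set.Icc (0 : ℝ) 1) (hq : 1 ≤ q) :
    FKGibbs d p q P where
  isProbabilityMeasure := hP.isProbabilityMeasure
  ae_subset_edgeSet := ae_subset_edgeSet' hP hp (one_pos.trans_le hq)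
  free_mul_le Λ _ _ T hA hAΛ hT hH := hP.regionFreeReal_mul_le hp hq Λ T hA hAΛ hT hH
  le_wired_mul Λ _ _ T hA hAΛ hT hH := hP.le_regionWiredReal_mul hp hq Λ T hA hAΛ hT hH

/-- **`rcLimit d b p q` satisfies `FKGibbs`** whenever a box limit exists (it does for `p ∈ [0,1]`, `q ≥ 1`:
`exists_isBoxLimit`, `InfiniteVolumeMeasures.lean`). [cite: Grimmett2006, Thm. (4.19)(a), Lemma (4.13), Lemma (4.14)(b)] -/
theorem fkGibbs_rcLimit_of_exists (hp : p ∈ Set.Icc (0 : ℝ) 1) (hq : 1 ≤ q)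
    (h : ∃ P : Measure (BondConfig (Site d)), IsBoxLimit d b p q P) : FKGibbs d p q (rcLimit d b p q) :=
  (isBoxLimit_rcLimit_of_exists h).fkGibbs hp hq

end Limit

end Summit.CriticalPhenomena.PercolationContinuityZ3.Theorems.FK

end
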